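import Literature.NumberTheory.GelbartRogawski1991.LocalMetaplecticL2CentralExtension
import HarnessLib

/-!
# A family of local splittings `𝓢 : FinLocalSplittings` in the printed unitary model: `s_v : U(J)(F_v) →* Mp_v(W)` over `L²(F_vᴺ)`

Topic `NumberTheory/GelbartRogawski1991`; namespace
`Literature.NumberTheory.GelbartRogawski1991.UnitaryDualPair.LocalSplitting.FinLocalSplittings` (+ two theorems in
`…GelbartRogawski1991.GRConstruction`).  KERNEL ONLY: two definitions with bodies (`omegaLocL2`, `sL2`) and proved theorems;
no named fact, no record, no `sorry`.

`LocalSplittingL2Metaplectic.lean` / `LocalMetaplecticL2CentralExtension.lean` put ONE local splitting DATUM into the printed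
group `Mp_v(W)` of bounded pairs over the unitary `ρ_{ψ_v}` on `L²(F_vᴺ)` (`localMpL2Bdd`).  The consumers downstream of
[GelbartRogawski1991, Prop. 3.1.1] in the tree (the finite-adelic assembly, the CM families `finLocalSplittingsCM`, the END display's
`muLocalSplittings = congrW … (undoubledSplittings … (cmFinLocalFamily …))`) work with the structure `FinLocalSplittings`
(`FiniteAdelicSplittingAssembly.lean`: `s v : U(J)(F_v) →* S̃p_{ψ_v}(𝕎_v)` over `ι_v`, smooth, unramified a.e.).  This file is the
same passage for that structure, under the one hypothesis that `𝓢.omegaLoc v` is `L²`-ISOMETRIC (proved for the CM families in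
`LocalSplittingUnitary.lean` / `UndoubledSplittingsUnitary.lean`):

* §1 **`𝓢.omegaLocL2 v hiso μ' : U(J)(F_v) →* (L² ≃ₗᵢ[ℂ] L²)`** (unitary extension of `𝓢.omegaLoc v`), `omegaLocL2_apply_toLp`,
  strong continuity (`continuous_omegaLocL2_apply`, from `𝓢.smooth`), `iota_omegaLocL2_mem` (the unitary pair implements `ι_v g`);
* §2 **`𝓢.sL2 v hiso μ' : U(J)(F_v) →* localMpL2Bdd F N T v μ'`** — `g ↦ (ι_v g, U_g)` in the printed `Mp_v(W)`; `proj_sL2` (`π_v ∘ s_v = ι_v`),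
  `sL2_op_apply(_toLp)`, `norm_sL2_op_apply`; uniqueness up to a unitary character of any other homomorphism into `Mp_v(W)` over
  `ι_v` acting by isometries (`exists_unitary_character_of_proj_eq`);
* §3 the CM instances, unconditionally: `exists_sL2_finLocalSplittingsCM` and
  `GRConstruction.exists_sL2_congrW_undoubledSplittings_cmFinLocalFamily` (the END display's family): at every finite place a
  homomorphism `U(J)(L⁺_v) →* Mp_v(W)` over `ι_v` by unitary, strongly continuous operators extending `𝓢.omegaLoc v`.

Nothing of the cited sources is asserted; `Prop311AsPrinted` is untouched; HC_CM is not touched.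

## References
* [GelbartRogawski1991] S. Gelbart, J. Rogawski, Invent. Math. 105 (1991) 445–472, §3.1 pp. 454–455, Remark p. 457.
* [Weil1964] A. Weil, Acta Math. 111 (1964) 143–211, Chap. I n° 13.
* [MoeglinVignerasWaldspurger1987] C. Mœglin, M.-F. Vignéras, J.-L. Waldspurger, LNM 1291 (1987), Chap. 2 II.1.
-/

set_option autoImplicit false

noncomputable section

open scoped Kronecker
open NumberField IsDedekindDomain _root_.MeasureTheory Matrix
open Literature.RepresentationTheory.HeisenbergGroup
open Literature.NumberTheory.Automorphic Literature.NumberTheory.Weil1964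
open Literature.NumberTheory.GaloisRepresentations Literature.RepresentationTheory.HarrisKudlaSweet1996
open Literature.NumberTheory.GaloisRepresentations.IsNonarchimedeanLocalField

namespace Literature.NumberTheory.GelbartRogawski1991.UnitaryDualPair.LocalSplitting

namespace FinLocalSplittings

variable {F : Type} [Field F] [NumberField F] {E : Type} [Field E] [NumberField E] [Algebra F E]
  [Algebra.IsQuadraticExtension F E] {c : E ≃ₐ[F] E} {N : ℕ} {δ : E} {hcδ : c δ = -δ} {hδ : δ ≠ 0} {d : F}
  {hd : δ * δ = algebraMap F E d} {T : Matrix (Fin N) (Fin N) F} {hT : T.IsSymm}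
  {J : Matrix (Fin N) (Fin N) E} {hJ : J = T.map (algebraMap F E)}
  (𝓢 : FinLocalSplittings F E c N hcδ hδ hd T hT hJ) (v : HeightOneSpectrum (𝓞 F))
  [MeasurableSpace (v.adicCompletion F)] [BorelSpace (v.adicCompletion F)]
  (μ' : Measure (v.adicCompletion F)) [μ'.IsAddHaarMeasure]
  (hiso : (𝓢.omegaLoc v).IsL2Isometric (Measure.pi fun _ : Fin N => μ'))

/-! ## §1 The unitary extension of `𝓢.omegaLoc v` -/

/-- **the unitary representation of `U(J)(F_v)` on `L²(F_vᴺ, μ'ᴺ)` extending `𝓢.omegaLoc v`** (for an `L²`-isometric family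
member). [cite: Weil1964, Chap. I n° 13] [cite: GelbartRogawski1991, §3.1 p. 454 L21–25] -/
def omegaLocL2 : UnitaryGroup.localPi E c N J v →*
    (Lp ℂ 2 (Measure.pi fun _ : Fin N => μ') ≃ₗᵢ[ℂ] Lp ℂ 2 (Measure.pi fun _ : Fin N => μ')) := by
  haveI := secondCountableTopology_adicCompletion F v
  exact hiso.toUnitaryRep (SchwartzBruhat.denseRange_toLp_adicCompletionPi F v N μ')

/-- `U_g [Φ] = [ω_v(g) Φ]`. [cite: Weil1964, Chap. I n° 13] -/
theorem omegaLocL2_apply_toLp (g : UnitaryGroup.localPi E c N J v) (Φ : SchwartzBruhat (Fin N → v.adicCompletion F)) :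
    haveI := secondCountableTopology_adicCompletion F v
    𝓢.omegaLocL2 v μ' hiso g (SchwartzBruhat.toLp (Measure.pi fun _ : Fin N => μ') Φ) =
      SchwartzBruhat.toLp (Measure.pi fun _ : Fin N => μ') (𝓢.omegaLoc v g Φ) := by
  haveI := secondCountableTopology_adicCompletion F v
  exact hiso.toUnitaryRep_apply_toLp _ g Φ

/-- strong continuity of `g ↦ U_g f` (from `𝓢.smooth`). [cite: Weil1964, Chap. I n° 13] -/
theorem continuous_omegaLocL2_apply (f : Lp ℂ 2 (Measure.pi fun _ : Fin N => μ')) :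
    Continuous fun g : UnitaryGroup.localPi E c N J v => 𝓢.omegaLocL2 v μ' hiso g f := by
  haveI := secondCountableTopology_adicCompletion F v
  exact hiso.continuous_toUnitaryRep_apply_of_isSmooth _ (𝓢.isSmooth_omegaLoc v) f

/-- `‖U_g f‖ = ‖f‖`. [cite: Weil1964, Chap. I n° 13] -/
theorem norm_omegaLocL2_apply (g : UnitaryGroup.localPi E c N J v) (f : Lp ℂ 2 (Measure.pi fun _ : Fin N => μ')) :
    ‖𝓢.omegaLocL2 v μ' hiso g f‖ = ‖f‖ :=
  (𝓢.omegaLocL2 v μ' hiso g).norm_map f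

variable {v} in
/-- **`(ι_v g, U_g)` is a pair of `Mp_v(W)`** over the unitary `ρ_{ψ_v}`: `U_g ρ_{ψ_v}(h) = ρ_{ψ_v}(ι_v(g) h) U_g` on `L²(F_vᴺ)`
(transfer of `omegaLoc_implements` by density). [cite: GelbartRogawski1991, §3.1 p. 454 L21–24] [cite: MoeglinVignerasWaldspurger1987, Chap. 2 II.1 (A)] -/
theorem iota_omegaLocL2_mem (g : UnitaryGroup.localPi E c N J v) :
    (iota F E c N hcδ hδ hd T hT hJ v g, (𝓢.omegaLocL2 v μ' hiso g).toLinearEquiv) ∈ localMpL2Bdd F N T v μ' := by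
  haveI := secondCountableTopology_adicCompletion F v
  refine (mem_localMpL2Bdd F N T v μ' _).2 ⟨?_, (𝓢.omegaLocL2 v μ' hiso g).continuous, (𝓢.omegaLocL2 v μ' hiso g).symm.continuous⟩
  have hp : (𝓢.s v g).1 ∈ MpPsi (localSchrodinger F N T v) := (𝓢.s v g).2
  have h1 : (𝓢.s v g).1.1 = iota F E c N hcδ hδ hd T hT hJ v g := 𝓢.fst_s v g
  have key := mem_MpPsi_schrodingerL2_of_mem (localPairing F N T v) (adeleAddCharAt F v)
    (isLocallyConstant_of_isContinuousNontrivial (isContinuousNontrivial_adeleAddCharAt F v))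
    (continuous_toLinearMap₂'_left (localGram F N T v)) (Measure.pi fun _ : Fin N => μ')
    (SchwartzBruhat.denseRange_toLp_adicCompletionPi F v N μ') hiso g hp (fun Φ => rfl)
  rw [h1] at key
  exact key

/-! ## §2 The homomorphism into the printed `Mp_v(W)` -/

/-- **`s_v : U(J)(F_v) →* Mp_v(W)`**, `g ↦ (ι_v g, U_g)`, for an `L²`-isometric member of a family of local splittings.
[cite: GelbartRogawski1991, §3.1 Prop. 3.1.1 p. 455 L1–3] -/
def sL2 : UnitaryGroup.localPi E c N J v →* localMpL2Bdd F N T v μ' where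
  toFun g := ⟨(iota F E c N hcδ hδ hd T hT hJ v g, (𝓢.omegaLocL2 v μ' hiso g).toLinearEquiv), 𝓢.iota_omegaLocL2_mem μ' hiso g⟩
  map_one' := by
    apply Subtype.ext
    refine Prod.ext (map_one _) ?_
    show (𝓢.omegaLocL2 v μ' hiso 1).toLinearEquiv = 1
    rw [map_one]
    rfl
  map_mul' g g' := by
    apply Subtype.ext
    refine Prod.ext (map_mul _ g g') ?_
    show (𝓢.omegaLocL2 v μ' hiso (g * g')).toLinearEquiv =
      (𝓢.omegaLocL2 v μ' hiso g).toLinearEquiv * (𝓢.omegaLocL2 v μ' hiso g').toLinearEquiv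
    rw [map_mul]
    rfl

/-- **`π_v ∘ s_v = ι_v`**. [cite: GelbartRogawski1991, §3.1 Prop. 3.1.1 p. 455 L1] -/
theorem proj_sL2 (g : UnitaryGroup.localPi E c N J v) :
    localMpL2Bdd.proj F N T v μ' (𝓢.sL2 v μ' hiso g) = iota F E c N hcδ hδ hd T hT hJ v g := rfl

/-- the operator of `s_v(g)` is `U_g`. [cite: GelbartRogawski1991, §3.1 p. 454 L24–25] -/
theorem sL2_op_apply (g : UnitaryGroup.localPi E c N J v) (f : Lp ℂ 2 (Measure.pi fun _ : Fin N => μ')) :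
    (𝓢.sL2 v μ' hiso g).1.2 f = 𝓢.omegaLocL2 v μ' hiso g f := rfl

/-- `s_v(g)` acts by isometries of `L²(F_vᴺ)`. [cite: GelbartRogawski1991, §3.1 p. 454 L24–25] -/
theorem norm_sL2_op_apply (g : UnitaryGroup.localPi E c N J v) (f : Lp ℂ 2 (Measure.pi fun _ : Fin N => μ')) :
    ‖(𝓢.sL2 v μ' hiso g).1.2 f‖ = ‖f‖ :=
  𝓢.norm_omegaLocL2_apply v μ' hiso g f

/-- `s_v(g)` extends `ω_v(g)`: `U_g [Φ] = [ω_v(g) Φ]`. [cite: MoeglinVignerasWaldspurger1987, Chap. 2 II.1] -/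
theorem sL2_op_apply_toLp (g : UnitaryGroup.localPi E c N J v) (Φ : SchwartzBruhat (Fin N → v.adicCompletion F)) :
    haveI := secondCountableTopology_adicCompletion F v
    (𝓢.sL2 v μ' hiso g).1.2 (SchwartzBruhat.toLp (Measure.pi fun _ : Fin N => μ') Φ) =
      SchwartzBruhat.toLp (Measure.pi fun _ : Fin N => μ') (𝓢.omegaLoc v g Φ) :=
  𝓢.omegaLocL2_apply_toLp v μ' hiso g Φ

/-- **uniqueness up to a UNITARY character**: any other homomorphism `s' : U(J)(F_v) →* Mp_v(W)` over `ι_v` acting by isometries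
is `s'(g) = i(η g) · s_v(g)` for a character `η` with `|η| = 1` — the local, unitary-model form of [GelbartRogawski1991, §3.1 Remark
p. 457]. [cite: GelbartRogawski1991, §3.1 Remark p. 457 L4–13] -/
theorem exists_unitary_character_of_proj_eq (hTd : IsUnit T.det) (s' : UnitaryGroup.localPi E c N J v →* localMpL2Bdd F N T v μ')
    (hs' : ∀ g, localMpL2Bdd.proj F N T v μ' (s' g) = iota F E c N hcδ hδ hd T hT hJ v g) (hs'i : ∀ g f, ‖(s' g).1.2 f‖ = ‖f‖) :
    ∃ η : UnitaryGroup.localPi E c N J v →* ℂˣ,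
      (∀ g, s' g = localMpL2Bdd.ofScalar F N T v μ' (η g) * 𝓢.sL2 v μ' hiso g) ∧ ∀ g, ‖((η g : ℂˣ) : ℂ)‖ = 1 := by
  obtain ⟨η, hη⟩ := localMpL2Bdd.exists_character_of_proj_eq F N T v μ' hTd (𝓢.sL2 v μ' hiso) s'
    (fun g => by rw [hs', proj_sL2])
  exact ⟨η, hη, localMpL2Bdd.norm_character_eq_one_of_proj_eq F N T v μ' _ _ (𝓢.norm_sL2_op_apply v μ' hiso) hs'i η hη⟩

end FinLocalSplittings

/-! ## §3 The CM families -/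

section CM

variable (L : Type) [Field L] [NumberField L] [IsCMField L] (n : ℕ) {T₀ : Matrix (Fin n) (Fin n) (maximalRealSubfield L)}
  (hT₀ : T₀.IsSymm) (hT₀d : IsUnit T₀.det) {J : Matrix (Fin n) (Fin n) L}
  (hJ : J = T₀.map (algebraMap (maximalRealSubfield L) L)) (χ : HeckeCharacter L) (hχ : IsSplittingChar L 1 χ)
  (v : HeightOneSpectrum (𝓞 (maximalRealSubfield L)))

/-- **the CM family `finLocalSplittingsCM χ` in the printed unitary model**, unconditionally (`χ` unitary): at every finite place a
homomorphism `U(J)(L⁺_v) →* Mp_v(W)` over `ι_v` whose operators are unitary, strongly continuous, and extend `ω_v`.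
[cite: GelbartRogawski1991, §3.1 Prop. 3.1.1 p. 455 L1–3] -/
theorem exists_sL2_finLocalSplittingsCM (hχu : χ.IsUnitary)
    [MeasurableSpace (v.adicCompletion (maximalRealSubfield L))] [BorelSpace (v.adicCompletion (maximalRealSubfield L))]
    (μ' : Measure (v.adicCompletion (maximalRealSubfield L))) [μ'.IsAddHaarMeasure] :
    haveI := secondCountableTopology_adicCompletion (maximalRealSubfield L) v
    ∃ s : UnitaryGroup.localPi L (IsCMField.complexConj L) n J v →* localMpL2Bdd (maximalRealSubfield L) n T₀ v μ',
      (∀ g, localMpL2Bdd.proj _ _ _ _ _ (s g) =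
        iota (maximalRealSubfield L) L (IsCMField.complexConj L) n (complexConj_imagUnit L) (imagUnit_ne_zero L)
          (imagUnit_mul_self L) T₀ hT₀ hJ v g) ∧
      (∀ g f, ‖(s g).1.2 f‖ = ‖f‖) ∧ (∀ f, Continuous fun g => (s g).1.2 f) ∧
      ∀ g (Φ : SchwartzBruhat (Fin n → v.adicCompletion (maximalRealSubfield L))),
        (s g).1.2 (SchwartzBruhat.toLp (Measure.pi fun _ : Fin n => μ') Φ) =
          SchwartzBruhat.toLp (Measure.pi fun _ : Fin n => μ') (((finLocalSplittingsCM L n hT₀ hT₀d hJ χ hχ).omegaLoc v) g Φ) := by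
  haveI := secondCountableTopology_adicCompletion (maximalRealSubfield L) v
  have hiso := FinLocalSplittings.isL2Isometric_omegaLoc_finLocalSplittingsCM L n hT₀ hT₀d hJ χ hχ v hχu μ'
  exact ⟨(finLocalSplittingsCM L n hT₀ hT₀d hJ χ hχ).sL2 v μ' hiso, fun g => rfl,
    (finLocalSplittingsCM L n hT₀ hT₀d hJ χ hχ).norm_sL2_op_apply v μ' hiso,
    (finLocalSplittingsCM L n hT₀ hT₀d hJ χ hχ).continuous_omegaLocL2_apply v μ' hiso,
    (finLocalSplittingsCM L n hT₀ hT₀d hJ χ hχ).sL2_op_apply_toLp v μ' hiso⟩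

end CM

end Literature.NumberTheory.GelbartRogawski1991.UnitaryDualPair.LocalSplitting

namespace Literature.NumberTheory.GelbartRogawski1991.GRConstruction

open UnitaryDualPair
open Literature.NumberTheory.GelbartRogawski1991.UnitaryDualPair.LocalSplitting hiding IsSiegelDelta chiDet deltaBlock
  detDelta e₂ gramD gramD_isSymm gramS hermD isUnit_det_gramD

variable (L : Type) [Field L] [NumberField L] [IsCMField L]
variable {N M n : ℕ} (e : Fin N × Fin M ≃ Fin n)
  (dV : Fin N → L) (hdV : ∀ i, IsCMField.complexConj L (dV i) = dV i) (hdV0 : ∀ i, dV i ≠ 0)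
  (dW : Fin M → L) (hdW : ∀ i, IsCMField.complexConj L (dW i) = dW i) (hdW0 : ∀ i, dW i ≠ 0)
  (χ : HeckeCharacter L) (hχ : IsSplittingChar L 1 χ) (𝔪 : ∀ v, PlaceMeasure L v)
  (v : HeightOneSpectrum (𝓞 (Fp L)))
  {TW' : Matrix (Fin M) (Fin M) (Fp L)} {JW' : Matrix (Fin M) (Fin M) L}

/-- **the END display's family of local splittings** (`congrW … (undoubledSplittings … (cmFinLocalFamily χ …))`, the shape of
`muLocalSplittings`) **in the printed unitary model**: at every finite place `v` a homomorphism `U(diag dV ⊗ J_{W′})(L⁺_v) →* Mp_v(W)`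
over `ι_v` by unitary, strongly continuous operators extending `𝓢.omegaLoc v` (`χ` unitary; any Borel structure, any Haar `μ'`).
[cite: GelbartRogawski1991, §3.1 Prop. 3.1.1 p. 455 L1–3, p. 454 L21–25] -/
theorem exists_sL2_congrW_undoubledSplittings_cmFinLocalFamily (hχu : χ.IsUnitary)
    (hT : realDiagonal L dW hdW = TW') (hJ : Matrix.diagonal dW = JW') (hW' : TW'.IsSymm)
    (hJW' : JW' = TW'.map (algebraMap (Fp L) L))
    [MeasurableSpace (v.adicCompletion (Fp L))] [BorelSpace (v.adicCompletion (Fp L))]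
    (μ' : Measure (v.adicCompletion (Fp L))) [μ'.IsAddHaarMeasure] :
    haveI := secondCountableTopology_adicCompletion (Fp L) v
    ∃ s : UnitaryGroup.localPi L (IsCMField.complexConj L) n (Matrix.reindex e e (Matrix.diagonal dV ⊗ₖ JW')) v →*
        localMpL2Bdd (Fp L) n (gram (Fp L) e (realDiagonal L dV hdV) TW') v μ',
      (∀ g, localMpL2Bdd.proj _ _ _ _ _ (s g) =
        iota (Fp L) L (IsCMField.complexConj L) n (complexConj_imagUnit L) (imagUnit_ne_zero L) (imagUnit_mul_self L)
          (gram (Fp L) e (realDiagonal L dV hdV) TW') (isSymm_gram (Fp L) e (realDiagonal_isSymm L dV hdV) hW')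
          (reindex_kronecker_eq_gram_map (Fp L) L e (realDiagonal_map L dV hdV).symm hJW') v g) ∧
      (∀ g f, ‖(s g).1.2 f‖ = ‖f‖) ∧ (∀ f, Continuous fun g => (s g).1.2 f) ∧
      ∀ g (Φ : SchwartzBruhat (Fin n → v.adicCompletion (Fp L))),
        (s g).1.2 (SchwartzBruhat.toLp (Measure.pi fun _ : Fin n => μ') Φ) =
          SchwartzBruhat.toLp (Measure.pi fun _ : Fin n => μ')
            (((congrW L e dV hdV dW hdW hT hJ
                (undoubledSplittings L e dV hdV hdV0 dW hdW hdW0 χ 𝔪 (cmFinLocalFamily L e dV hdV hdV0 dW hdW hdW0 χ hχ 𝔪))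
                hW' hJW').omegaLoc v) g Φ) := by
  haveI := secondCountableTopology_adicCompletion (Fp L) v
  have hiso := isL2Isometric_omegaLoc_congrW_undoubledSplittings_cmFinLocalFamily L e dV hdV hdV0 dW hdW hdW0 χ hχ 𝔪 v hχu hT hJ
    hW' hJW' μ'
  exact ⟨FinLocalSplittings.sL2 _ v μ' hiso, fun g => rfl, FinLocalSplittings.norm_sL2_op_apply _ v μ' hiso,
    FinLocalSplittings.continuous_omegaLocL2_apply _ v μ' hiso, FinLocalSplittings.sL2_op_apply_toLp _ v μ' hiso⟩

end Literature.NumberTheory.GelbartRogawski1991.GRConstruction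

end
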